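import Summits.QuantumFields.YangMills.Theorems.IR.AfPincerUcCompactWitness
import HarnessLib

/-!
# Crux `IR` (stmt-QuantumFields-19354), line `af-pincer`, X-side: the AF WINDOW and the femto packages depend only on the
# SCALING CLASS of the UV scale ∕ unit — the «UV∧NT matching statement» reduced to one comparability bit

Seat ym-19354-afpincer-s2 (generation 5; X-desk of lane (1)A, slot «sharp merge I♯_SC» 28967a1bf60ad397).  Helper module for item
`stmt-QuantumFields-19354` (`--supports stmt-QuantumFields-19354 --as helper`; it closes nothing).

WHY.  The LEAD's located strength comparison (`Theorems/IR/AfPincerUcSharpLanes` §5) ends «`TypFormatAtScaleAt … ℓ_AF` is STRONGER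
than I♯ at `(G, r, a)` unless `ℓ_AF ≳ 1/a` too (a UV∧NT matching statement nobody owes yet)», and generation 4 observed that when the
UV desk delivers its femto package in the SAME unit as the NT desk (SU(2): `u = uRec` in `closes`) the matching is automatic.  This file
settles the bookkeeping half of that remark in the kernel, once and for all:

* §1 **The window is a statement about the Θ-class of its scale.**  `SharpLanes.CovWindowAt G r ℓ ↔ CovWindowAt G r (K·ℓ)` for EVERY
  constant `K > 0` (`covWindowAt_const_mul_pos`, `covWindowAt_iff_const_mul_pos`: the factor `T′(W)` absorbs `K`; the tree's
  `covWindowAt_const_mul` had only `K ≤ 1` under `0 ≤ ℓ`).  Hence the set of scales carrying the window is a DOWN-SET OF SCALING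
  CLASSES (`covWindowAt_of_le_const_mul`), and in unit form: the window at `1/u` gives the window at `1/a` as soon as `u = O(a)`
  (`covWindowAt_inv_of_unit_le_mul`); for comparable units `u ≍ a` the two windows are EQUIVALENT (`covWindowAt_inv_iff_of_comparable`).
* §2 The same for the I-side target: `SharpLanes.TypFormatAtScaleAt ρ n ε ℓ` depends only on the Θ-class of `ℓ`
  (`typFormatAtScaleAt_iff_of_comparable`; one direction is the tree's `typFormatAtScaleAt_mono`).
* §3 **The femto packages scale EXACTLY with the unit**: `Femto.CondOscAt ∕ CondCovAFAt ∕ FemtoAFAt ∕ TemperedFemtoAFAt` at unit `K·u`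
  are the same statements at unit `u` with the physical collar∕range `(κ, ℓ)` replaced by `(κ/K, ℓ/K)` — so `FemtoAFAt G r u ↔
  FemtoAFAt G r (K·u)` and `TemperedFemtoAFAt G r u ↔ TemperedFemtoAFAt G r (K·u)` (`femtoAFAt_iff_const_mul`,
  `temperedFemtoAFAt_iff_const_mul`); with §1, a femto package in ANY unit `u = O(a)` gives the window at the NT unit
  (`covWindowAt_inv_of_femtoAFAt_of_unit_le_mul`, tempered twin).
* §4 **The matching, located.**  At `(G, r, a)` with compact-witness floors `Compact.LowerBoundsCpt G r a`, a UV unit `u` carrying the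
  window satisfies `a = O(u)` FOR FREE (the PIN, generation 3's `Femto.unit_lt_mul_of_covWindowAt_compactWitness`); the window at the NT
  unit follows iff ALSO `u = O(a)`.  So the admissible UV units at `(G, r, a)` are exactly the Θ-class of `a`
  (`comparable_of_covWindowAt_inv_of_unit_le_mul`), the only matching DATUM is the one bit «`u ≤ K·a` eventually», and it is EMPTY when
  the UV desk adopts the NT unit or any fixed multiple of it (`covWindowAt_inv_iff_of_comparable` with `u = c·a`).  The envelope-free
  lane (1)A contract in unit form (`Compact.LaneAFemtoWindowContractSC`) may therefore be assembled from an I-side format at scale `1/u′`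
  and a femto package at unit `u` for ANY two comparable units (`exists_unit_contract_of_comparable`).

HONEST FRAMING: arithmetic on the binders of OPEN statements (the window, the femto packages, the format-at-scale are all open; the
floors are the NT desk's open stub); one open gap-crux of a CONDITIONAL chain (Track A 0/28 UV); not AF, not mixing, not a gap, not Clay.
No `sorry`; axioms ⊆ {propext, Classical.choice, Quot.sound}.
-/

set_option autoImplicit false

noncomputable section

open Filter Topology MeasureTheory
open scoped SchwartzMap
open Literature.MathematicalPhysics.QuantumFieldTheory hiding ZdEdge
open Literature.MathematicalPhysics.QuantumLattice
open Literature.Probability.LatticeModels (Site box mem_box)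
open Summit.QuantumFields.YangMills.Cruxes.OSLegsFromFemtoAndGap.DlrCollarTransfer

namespace Summit.QuantumFields.YangMills.Cruxes.IR.AfPincerUc.ScaleClass

open Summit.QuantumFields.YangMills.Cruxes.IR.AfPincerUc
open Summit.QuantumFields.YangMills.Cruxes.IR.AfPincerUc.SharpLanes
open Summit.QuantumFields.YangMills.Cruxes.IR.AfPincerUc.Femto
open Summit.QuantumFields.YangMills.Cruxes.IR.AfPincerUc.Compact

variable {G : Type} [Group G] [TopologicalSpace G] [IsTopologicalGroup G] [CompactSpace G]
  [MeasurableSpace G] [BorelSpace G]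

/-! ## §1 The AF window depends only on the scaling class of its scale -/
section Window

variable {r : LatticeRep G}

/-- **The window tolerates EVERY positive constant factor (PROVED, arithmetic):** `CovWindowAt G r ℓ → CovWindowAt G r (K·ℓ)` for
`K > 0` — the separation factor `T′(W)` of the window at `ℓ` becomes `K·T′(W)`, since `K T′‖x−y‖ ≤ K ℓ(β) ↔ T′‖x−y‖ ≤ ℓ(β)`.  No sign or
size condition on `ℓ` (compare the tree's `SharpLanes.covWindowAt_const_mul`: `K ≤ 1`, `0 ≤ ℓ` eventually). -/
theorem covWindowAt_const_mul_pos {ℓ : ℝ → ℝ} (h : CovWindowAt G r ℓ) {K : ℝ} (hK : 0 < K) :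
    CovWindowAt G r (fun β => K * ℓ β) := by
  intro W hW
  obtain ⟨T', β₀, hT', hβ⟩ := h W hW
  refine ⟨K * T', β₀, mul_pos hK hT', fun β hb => ?_⟩
  filter_upwards [hβ β hb] with L hL x hx y hy hxy hT
  refine hL x hx y hy hxy ?_
  have e : K * T' * ‖x - y‖ = K * (T' * ‖x - y‖) := by ring
  rw [e] at hT
  exact le_of_mul_le_mul_left hT hK

/-- **The window is a statement about the Θ-class of the scale (PROVED):** `CovWindowAt G r (K·ℓ) ↔ CovWindowAt G r ℓ` for every
`K > 0`. -/
theorem covWindowAt_iff_const_mul_pos {ℓ : ℝ → ℝ} {K : ℝ} (hK : 0 < K) :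
    CovWindowAt G r (fun β => K * ℓ β) ↔ CovWindowAt G r ℓ := by
  refine ⟨fun h => ?_, fun h => covWindowAt_const_mul_pos h hK⟩
  have h' := covWindowAt_const_mul_pos h (inv_pos.2 hK)
  have e : (fun β => K⁻¹ * (K * ℓ β)) = ℓ := by
    funext β
    rw [← mul_assoc, inv_mul_cancel₀ hK.ne', one_mul]
  rwa [e] at h'

/-- **The scales carrying the window form a down-set of scaling classes (PROVED):** a window at `ℓ` is a window at every `ℓ′` with
`ℓ′ ≤ K·ℓ` eventually, ANY `K > 0` (`covWindowAt_const_mul_pos` + the tree's `covWindowAt_anti`). -/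
theorem covWindowAt_of_le_const_mul {ℓ ℓ' : ℝ → ℝ} (h : CovWindowAt G r ℓ) {K : ℝ} (hK : 0 < K)
    (hle : ∃ β₃ : ℝ, ∀ β : ℝ, β₃ ≤ β → ℓ' β ≤ K * ℓ β) : CovWindowAt G r ℓ' :=
  covWindowAt_anti (covWindowAt_const_mul_pos h hK) hle

/-- Comparable scales carry the same window (PROVED): if `ℓ′ ≤ K·ℓ` and `ℓ ≤ K′·ℓ′` eventually (`K, K′ > 0`), then
`CovWindowAt G r ℓ ↔ CovWindowAt G r ℓ′`. -/
theorem covWindowAt_iff_of_comparable {ℓ ℓ' : ℝ → ℝ} {K K' : ℝ} (hK : 0 < K) (hK' : 0 < K')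
    (hle : ∃ β₃ : ℝ, ∀ β : ℝ, β₃ ≤ β → ℓ' β ≤ K * ℓ β) (hge : ∃ β₃ : ℝ, ∀ β : ℝ, β₃ ≤ β → ℓ β ≤ K' * ℓ' β) :
    CovWindowAt G r ℓ ↔ CovWindowAt G r ℓ' :=
  ⟨fun h => covWindowAt_of_le_const_mul h hK hle, fun h => covWindowAt_of_le_const_mul h hK' hge⟩

/-- **Unit form (PROVED): the window at the UV unit `u` gives the window at the NT unit `a` as soon as `u = O(a)`** — from
`u β ≤ K·a β` eventually, `1/a β ≤ K·(1/u β)`.  This is the WHOLE «UV∧NT matching» datum on the X-side: the other comparability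
`a = O(u)` is forced by the floors (§4). -/
theorem covWindowAt_inv_of_unit_le_mul {a u : ℝ → ℝ} (ha : ∀ β, 0 < a β) (hu : ∀ β, 0 < u β)
    (hwin : CovWindowAt G r (fun β => 1 / u β)) {K : ℝ} (hK : 0 < K)
    (hle : ∃ β₃ : ℝ, ∀ β : ℝ, β₃ ≤ β → u β ≤ K * a β) : CovWindowAt G r (fun β => 1 / a β) := by
  refine covWindowAt_of_le_const_mul hwin hK ?_
  obtain ⟨β₃, hβ₃⟩ := hle
  refine ⟨β₃, fun β hβ => ?_⟩
  have h1 := hβ₃ β hβ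
  have ha' := ha β
  have hu' := hu β
  rw [mul_one_div, div_le_div_iff₀ ha' hu', one_mul]
  exact h1

/-- **Comparable units carry the same window (PROVED):** `u ≤ K·a` and `a ≤ K′·u` eventually ⇒
`CovWindowAt G r (1/u) ↔ CovWindowAt G r (1/a)`.  In particular the window at ANY fixed multiple `c·a` of the NT unit is the window at
the NT unit. -/
theorem covWindowAt_inv_iff_of_comparable {a u : ℝ → ℝ} (ha : ∀ β, 0 < a β) (hu : ∀ β, 0 < u β) {K K' : ℝ}
    (hK : 0 < K) (hK' : 0 < K') (hle : ∃ β₃ : ℝ, ∀ β : ℝ, β₃ ≤ β → u β ≤ K * a β)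
    (hge : ∃ β₃ : ℝ, ∀ β : ℝ, β₃ ≤ β → a β ≤ K' * u β) :
    CovWindowAt G r (fun β => 1 / u β) ↔ CovWindowAt G r (fun β => 1 / a β) :=
  ⟨fun h => covWindowAt_inv_of_unit_le_mul ha hu h hK hle, fun h => covWindowAt_inv_of_unit_le_mul hu ha h hK' hge⟩

/-- The window at a fixed positive multiple of a unit is the window at the unit (PROVED; `1/(c·a) = c⁻¹·(1/a)`). -/
theorem covWindowAt_inv_const_mul_iff {a : ℝ → ℝ} (ha : ∀ β, 0 < a β) {c : ℝ} (hc : 0 < c) :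
    CovWindowAt G r (fun β => 1 / (c * a β)) ↔ CovWindowAt G r (fun β => 1 / a β) := by
  refine covWindowAt_inv_iff_of_comparable ha (fun β => mul_pos hc (ha β)) hc (inv_pos.2 hc) ⟨0, fun β _ => le_rfl⟩
    ⟨0, fun β _ => ?_⟩
  rw [← mul_assoc, inv_mul_cancel₀ hc.ne', one_mul]

end Window

/-! ## §2 The I-side target depends only on the scaling class of its scale -/
section Format

/-- Comparable scales carry the same format-at-scale (PROVED; both directions are the tree's `SharpLanes.typFormatAtScaleAt_mono`). -/
theorem typFormatAtScaleAt_iff_of_comparable {N : ℕ} {ρ : G →* Matrix (Fin N) (Fin N) ℂ} {n : ℕ} {ε : ℝ} {ℓ ℓ' : ℝ → ℝ}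
    {K K' : ℝ} (hK : 0 < K) (hK' : 0 < K')
    (hle : ∃ β₃ : ℝ, ∀ β : ℝ, β₃ ≤ β → ℓ' β ≤ K * ℓ β) (hge : ∃ β₃ : ℝ, ∀ β : ℝ, β₃ ≤ β → ℓ β ≤ K' * ℓ' β) :
    TypFormatAtScaleAt ρ n ε ℓ ↔ TypFormatAtScaleAt ρ n ε ℓ' :=
  ⟨fun h => typFormatAtScaleAt_mono h hK' hge, fun h => typFormatAtScaleAt_mono h hK hle⟩

/-- Unit form (PROVED): format at scale `1/u′` gives format at scale `1/u` as soon as `u ≤ K·u′` eventually (`1/u′ ≤ K·(1/u)`). -/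
theorem typFormatAtScaleAt_inv_of_unit_le_mul {N : ℕ} {ρ : G →* Matrix (Fin N) (Fin N) ℂ} {n : ℕ} {ε : ℝ} {u u' : ℝ → ℝ}
    (hu : ∀ β, 0 < u β) (hu' : ∀ β, 0 < u' β) (h : TypFormatAtScaleAt ρ n ε (fun β => 1 / u' β)) {K : ℝ} (hK : 0 < K)
    (hle : ∃ β₃ : ℝ, ∀ β : ℝ, β₃ ≤ β → u β ≤ K * u' β) : TypFormatAtScaleAt ρ n ε (fun β => 1 / u β) := by
  refine typFormatAtScaleAt_mono h hK ?_
  obtain ⟨β₃, hβ₃⟩ := hle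
  refine ⟨β₃, fun β hβ => ?_⟩
  have h1 := hβ₃ β hβ
  rw [mul_one_div, div_le_div_iff₀ (hu' β) (hu β), one_mul]
  exact h1

end Format

/-! ## §3 The femto packages scale exactly with the unit -/
section FemtoScaling

variable (r : LatticeRep G)

/-- Arithmetic of the unit change `u ↦ K·u` (`K > 0`): the femto-cube condition at unit `K·u` with range `K·ℓ` is the one at
unit `u` with range `ℓ`. -/
private theorem cube_iff {K : ℝ} (hK : 0 < K) (b uβ ℓ : ℝ) : b * (K * uβ) ≤ K * ℓ ↔ b * uβ ≤ ℓ := by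
  rw [show b * (K * uβ) = K * (b * uβ) by ring]
  exact ⟨fun h => le_of_mul_le_mul_left h hK, fun h => mul_le_mul_of_nonneg_left h hK.le⟩

/-- Arithmetic of the unit change: the collar `K·κ / (K·uβ) = κ / uβ`. -/
private theorem collar_eq {K : ℝ} (hK : 0 < K) (κ uβ : ℝ) : K * κ / (K * uβ) = κ / uβ :=
  mul_div_mul_left κ uβ hK.ne'

/-- **E1-osc scales exactly with the unit (PROVED):** for `u′ = K·u` (`K > 0`), `CondOscAt G r u κ ℓ C₁ → CondOscAt G r u′ (K·κ) (K·ℓ) C₁`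
(the converse is the same lemma at `K⁻¹`). -/
theorem condOscAt_unit_mul {u u' : ℝ → ℝ} {K : ℝ} (hK : 0 < K) (hu' : ∀ β, u' β = K * u β) {κ ℓ C₁ : ℝ}
    (h : CondOscAt G r u κ ℓ C₁) : CondOscAt G r u' (K * κ) (K * ℓ) C₁ := by
  obtain ⟨β₁, h⟩ := h
  refine ⟨β₁, fun β hβ c b hb η η' x hx => ?_⟩
  rw [hu'] at hb hx
  rw [collar_eq hK] at hx
  exact h β hβ c b ((cube_iff hK _ _ _).1 hb) η η' x hx

/-- **CondCovAF scales exactly with the unit (PROVED):** for `u′ = K·u` (`K > 0`), `CondCovAFAt G r u κ ℓ → CondCovAFAt G r u′ (K·κ) (K·ℓ)`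
(the physical separation range `s′` becomes `K·s′`; converse at `K⁻¹`). -/
theorem condCovAFAt_unit_mul {u u' : ℝ → ℝ} {K : ℝ} (hK : 0 < K) (hu' : ∀ β, u' β = K * u β) {κ ℓ : ℝ}
    (h : CondCovAFAt G r u κ ℓ) : CondCovAFAt G r u' (K * κ) (K * ℓ) := by
  obtain ⟨n₀, h⟩ := h
  refine ⟨n₀, fun W' hW' => ?_⟩
  obtain ⟨s', β', hs', h⟩ := h W' hW'
  refine ⟨K * s', β', mul_pos hK hs', fun β hβ c b hb η x y hn hx hy hs => ?_⟩
  rw [hu'] at hb hx hy hs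
  rw [collar_eq hK] at hx hy
  rw [show ‖siteToE (y - x)‖ * (K * u β) = K * (‖siteToE (y - x)‖ * u β) by ring] at hs
  exact h β hβ c b ((cube_iff hK _ _ _).1 hb) η x y hn hx hy (le_of_mul_le_mul_left hs hK)

/-- **The femto conditional AF package transports along `u′ = K·u` (PROVED):** `FemtoAFAt G r u → FemtoAFAt G r u′` (collar and range
rescale by `K`). -/
theorem femtoAFAt_unit_mul {u u' : ℝ → ℝ} {K : ℝ} (hK : 0 < K) (hu' : ∀ β, u' β = K * u β) (h : FemtoAFAt G r u) :
    FemtoAFAt G r u' := by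
  obtain ⟨κ, ℓ, C₁, hκ, hκℓ, hC₁, hE1, hAF⟩ := h
  refine ⟨K * κ, K * ℓ, C₁, mul_pos hK hκ, ?_, hC₁, condOscAt_unit_mul r hK hu' hE1, condCovAFAt_unit_mul r hK hu' hAF⟩
  rw [show 2 * (K * κ) = K * (2 * κ) by ring]
  exact mul_lt_mul_of_pos_left hκℓ hK

/-- **The femto conditional AF package is a statement about the Θ-class of the unit, exactly (PROVED):**
`FemtoAFAt G r (K·u) ↔ FemtoAFAt G r u` for every `K > 0`. -/
theorem femtoAFAt_iff_const_mul {u : ℝ → ℝ} {K : ℝ} (hK : 0 < K) :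
    FemtoAFAt G r (fun β => K * u β) ↔ FemtoAFAt G r u := by
  refine ⟨fun h => femtoAFAt_unit_mul r (inv_pos.2 hK) (fun β => ?_) h, fun h => femtoAFAt_unit_mul r hK (fun _ => rfl) h⟩
  rw [← mul_assoc, inv_mul_cancel₀ hK.ne', one_mul]

/-- **The tempered femto package transports along `u′ = K·u` (PROVED):** `TemperedFemtoAFAt G r u → TemperedFemtoAFAt G r u′`
(collar, range and separation rescale by `K`; the SAME good sets; the rarity budget `D·(u′ β)⁸ = (D K⁸)·(u β)⁸` ranges over all positive
constants either way). -/
theorem temperedFemtoAFAt_unit_mul {u u' : ℝ → ℝ} {K : ℝ} (hK : 0 < K) (hu' : ∀ β, u' β = K * u β)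
    (h : TemperedFemtoAFAt G r u) : TemperedFemtoAFAt G r u' := by
  have hK8 : 0 < K ^ 8 := pow_pos hK 8
  obtain ⟨κ, ℓ, C₁, Good, hκ, hκℓ, hC₁, hGm, ⟨β₁, hE1⟩, ⟨n₀, hAF⟩, hrare⟩ := h
  refine ⟨K * κ, K * ℓ, C₁, Good, mul_pos hK hκ, ?_, hC₁, hGm, ⟨β₁, ?_⟩, ⟨n₀, ?_⟩, ?_⟩
  · rw [show 2 * (K * κ) = K * (2 * κ) by ring]
    exact mul_lt_mul_of_pos_left hκℓ hK
  · intro β hβ c b hb η hη η' hη' x hx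
    rw [hu'] at hb hx
    rw [collar_eq hK] at hx
    exact hE1 β hβ c b ((cube_iff hK _ _ _).1 hb) η hη η' hη' x hx
  · intro W' hW'
    obtain ⟨s', β', hs', h⟩ := hAF W' hW'
    refine ⟨K * s', β', mul_pos hK hs', fun β hβ c b hb η hη x y hn hx hy hs => ?_⟩
    rw [hu'] at hb hx hy hs
    rw [collar_eq hK] at hx hy
    rw [show ‖siteToE (y - x)‖ * (K * u β) = K * (‖siteToE (y - x)‖ * u β) by ring] at hs
    exact h β hβ c b ((cube_iff hK _ _ _).1 hb) η hη x y hn hx hy (le_of_mul_le_mul_left hs hK)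
  · intro D hD
    obtain ⟨βD, hβD⟩ := hrare (D * K ^ 8) (mul_pos hD hK8)
    refine ⟨βD, fun β hβ c b hb L hL => ?_⟩
    rw [hu'] at hb ⊢
    refine (hβD β hβ c b ((cube_iff hK _ _ _).1 hb) L hL).trans (le_of_eq ?_)
    rw [mul_pow]; ring

/-- **The tempered femto package is a statement about the Θ-class of the unit, exactly (PROVED):**
`TemperedFemtoAFAt G r (K·u) ↔ TemperedFemtoAFAt G r u` for every `K > 0`. -/
theorem temperedFemtoAFAt_iff_const_mul {u : ℝ → ℝ} {K : ℝ} (hK : 0 < K) :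
    TemperedFemtoAFAt G r (fun β => K * u β) ↔ TemperedFemtoAFAt G r u := by
  refine ⟨fun h => temperedFemtoAFAt_unit_mul r (inv_pos.2 hK) (fun β => ?_) h,
    fun h => temperedFemtoAFAt_unit_mul r hK (fun _ => rfl) h⟩
  rw [← mul_assoc, inv_mul_cancel₀ hK.ne', one_mul]

/-- **A femto package in ANY unit `u = O(a)` gives the window at the NT unit (PROVED):** `FemtoAFAt G r u`, `u ≤ K·a` eventually ⇒
`CovWindowAt G r (1/a)` (generation 3's `covWindowAt_of_femtoAFAt` + §1). -/
theorem covWindowAt_inv_of_femtoAFAt_of_unit_le_mul {a u : ℝ → ℝ} (ha : ∀ β, 0 < a β) (hu : ∀ β, 0 < u β)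
    (h : FemtoAFAt G r u) {K : ℝ} (hK : 0 < K) (hle : ∃ β₃ : ℝ, ∀ β : ℝ, β₃ ≤ β → u β ≤ K * a β) :
    CovWindowAt G r (fun β => 1 / a β) :=
  covWindowAt_inv_of_unit_le_mul ha hu (covWindowAt_of_femtoAFAt r hu h) hK hle

/-- Tempered twin (PROVED): `TemperedFemtoAFAt G r u`, `u ≤ K·a` eventually ⇒ `CovWindowAt G r (1/a)`. -/
theorem covWindowAt_inv_of_temperedFemtoAFAt_of_unit_le_mul {a u : ℝ → ℝ} (ha : ∀ β, 0 < a β) (hu : ∀ β, 0 < u β)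
    (h : TemperedFemtoAFAt G r u) {K : ℝ} (hK : 0 < K) (hle : ∃ β₃ : ℝ, ∀ β : ℝ, β₃ ≤ β → u β ≤ K * a β) :
    CovWindowAt G r (fun β => 1 / a β) :=
  covWindowAt_inv_of_unit_le_mul ha hu (covWindowAt_of_temperedFemtoAFAt r hu h) hK hle

end FemtoScaling

/-! ## §4 The matching, located: at `(G, r, a)` the admissible UV units are exactly the Θ-class of `a` -/
section Matching

variable (r : LatticeRep G)

/-- **Half of the matching is free (the PIN, restated):** the window at a UV unit `u` and compact-witness floors at the NT unit `a`
force `a ≤ T₀·u` eventually (generation 3's `Femto.unit_lt_mul_of_covWindowAt_compactWitness` fed with clause (i) of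
`Compact.LowerBoundsCpt`). [kernel composition; the window and the floors are OPEN] -/
theorem unit_le_mul_of_covWindowAt_inv (a u : ℝ → ℝ) (ha : ∀ β, 0 < a β) (hu : ∀ β, 0 < u β)
    (hwin : CovWindowAt G r (fun β => 1 / u β)) (hlbc : LowerBoundsCpt G r a) :
    ∃ T₀ β₁ : ℝ, 0 < T₀ ∧ ∀ β : ℝ, β₁ ≤ β → a β ≤ T₀ * u β := by
  obtain ⟨T₀, β₁, hT⟩ :=
    unit_lt_mul_of_covWindowAt_compactWitness r a u ha hu hwin (compactWitness_of_lowerBoundsCpt hlbc)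
  have hT₀ : 0 < T₀ := by
    have h1 := hT β₁ le_rfl
    have hprod : 0 < T₀ * u β₁ := (ha β₁).trans h1
    have hu₁ := hu β₁
    by_contra hneg
    have hle : T₀ ≤ 0 := not_lt.mp hneg
    nlinarith
  exact ⟨T₀, β₁, hT₀, fun β hβ => (hT β hβ).le⟩

/-- **The admissible UV units at `(G, r, a)` are exactly the Θ-class of `a` (PROVED):** under compact-witness floors at `a`, a unit `u`
carrying the window with `u = O(a)` is COMPARABLE to `a` (`a = O(u)` by the pin, `u = O(a)` by hypothesis). -/
theorem comparable_of_covWindowAt_inv_of_unit_le_mul (a u : ℝ → ℝ) (ha : ∀ β, 0 < a β) (hu : ∀ β, 0 < u β)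
    (hwin : CovWindowAt G r (fun β => 1 / u β)) (hlbc : LowerBoundsCpt G r a) {K : ℝ} (hK : 0 < K)
    (hle : ∃ β₃ : ℝ, ∀ β : ℝ, β₃ ≤ β → u β ≤ K * a β) :
    ∃ K₁ K₂ β₁ : ℝ, 0 < K₁ ∧ 0 < K₂ ∧ ∀ β : ℝ, β₁ ≤ β → u β ≤ K₁ * a β ∧ a β ≤ K₂ * u β := by
  obtain ⟨T₀, β₁, hT₀, hT⟩ := unit_le_mul_of_covWindowAt_inv r a u ha hu hwin hlbc
  obtain ⟨β₃, hβ₃⟩ := hle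
  exact ⟨K, T₀, max β₁ β₃, hK, hT₀, fun β hβ =>
    ⟨hβ₃ β (le_trans (le_max_right _ _) hβ), hT β (le_trans (le_max_left _ _) hβ)⟩⟩

/-- **The X-side ask at the NT unit, final form (PROVED):** the window at the NT unit `a` holds iff it holds at SOME unit `u = O(a)` —
no floors needed for this equivalence (`u := a` one way, §1 the other).  With the pin, every unit carrying the window at `(G, r, a)` is
`≍ a`; so the UV desk may deliver leg-1 ∕ N29 in ANY unit of the Θ-class of the NT unit, all constants free. -/
theorem covWindowAt_inv_iff_exists_unit (a : ℝ → ℝ) (ha : ∀ β, 0 < a β) :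
    CovWindowAt G r (fun β => 1 / a β) ↔
      ∃ u : ℝ → ℝ, (∀ β, 0 < u β) ∧ CovWindowAt G r (fun β => 1 / u β) ∧
        ∃ K β₃ : ℝ, 0 < K ∧ ∀ β : ℝ, β₃ ≤ β → u β ≤ K * a β := by
  constructor
  · intro h
    exact ⟨a, ha, h, 1, 0, one_pos, fun β _ => by rw [one_mul]⟩
  · rintro ⟨u, hu, hwin, K, β₃, hK, hle⟩
    exact covWindowAt_inv_of_unit_le_mul ha hu hwin hK ⟨β₃, hle⟩

/-- **Assembling the envelope-free unit-form contract from two comparable units (PROVED):** per `(G, r)`, admissible `(n, ε)`, an I-side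
format at scale `1/u′` and a tempered femto package at unit `u` with `u ≤ K·u′` eventually give the per-`(G, r)` body of
`Compact.LaneAFemtoWindowContractSC` with the single unit `u` (format transported by §2).  So the I-desk and the UV desk need not agree on
a unit, only on its Θ-class. -/
theorem exists_unit_contract_of_comparable {n : ℕ} {ε : ℝ} {u u' : ℝ → ℝ} (hu : ∀ β, 0 < u β) (hu' : ∀ β, 0 < u' β)
    (hF : TypFormatAtScaleAt r.ρ n ε (fun β => 1 / u' β)) (hfem : TemperedFemtoAFAt G r u) {K : ℝ} (hK : 0 < K)
    (hle : ∃ β₃ : ℝ, ∀ β : ℝ, β₃ ≤ β → u β ≤ K * u' β) :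
    ∃ v : ℝ → ℝ, (∀ β, 0 < v β) ∧ TypFormatAtScaleAt r.ρ n ε (fun β => 1 / v β) ∧ TemperedFemtoAFAt G r v :=
  ⟨u, hu, typFormatAtScaleAt_inv_of_unit_le_mul hu hu' hF hK hle, hfem⟩

/-- **… and the I♯ clause at `(G, r, a)` from data in two comparable units (PROVED):** format at scale `1/u′`, the window at unit `u`,
`u′ ≤ K·u` eventually, and compact-witness floors at `a` ⇒ for every budget `δ`, eventually a mesh `b` with `a β · b < T` carrying
`TypShellCondUKPc` (`Compact.onsetSharp_clause_of_laneA_cpt` at the scale `1/u`, format transported by §2). [kernel composition;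
hypotheses OPEN] -/
theorem onsetSharp_clause_of_comparable_units (a u u' : ℝ → ℝ) (ha : ∀ β, 0 < a β) (hu : ∀ β, 0 < u β)
    (hu' : ∀ β, 0 < u' β) {n : ℕ} {ε : ℝ} (hF : TypFormatAtScaleAt r.ρ n ε (fun β => 1 / u' β))
    (hwin : CovWindowAt G r (fun β => 1 / u β)) (hlbc : LowerBoundsCpt G r a) {K : ℝ} (hK : 0 < K)
    (hle : ∃ β₃ : ℝ, ∀ β : ℝ, β₃ ≤ β → u β ≤ K * u' β) :
    ∀ δ : ℝ, 0 < δ → ∃ T β₂ : ℝ, ∀ β : ℝ, β₂ ≤ β →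
      ∃ b : ℕ, 1 ≤ b ∧ a β * (b : ℝ) < T ∧ TypShellCondUKPc r.ρ β b n ε δ :=
  onsetSharp_clause_of_laneA_cpt r a (fun β => 1 / u β) ha hwin hlbc
    (typFormatAtScaleAt_inv_of_unit_le_mul hu hu' hF hK hle)

end Matching

end Summit.QuantumFields.YangMills.Cruxes.IR.AfPincerUc.ScaleClass

end
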